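import Mathlib
import HarnessLib
import Summits.HubbardSuperconductivity.HubbardSuperconductivity.Theorems.KLProgrammeKLRegimeSplitSymInterpPureMoments
import Summits.HubbardSuperconductivity.HubbardSuperconductivity.Theorems.KLProgrammeKLRegimeEngineFrameShiftMomentResponse

/-!
# K3 gen-8-FLOW (stmt 20437 `KLRegimeEngineV17F2`, stub (C), located risk «(C)-B-REP», design B-CT p2 g13): the COMPLEX READING-JET FUNCTIONAL
# — a `ℂ`-linear functional of complex lattice data whose REAL PART is a momentum jet of the symmetrised interpolant of the real part

Cell gate-hubbard-kl, seat p2 g13 (memo `B-CT-DESIGN-p2g13.md` §2).  The corrected (B) door of stub (C) runs Polchinski's interpolation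
(`Literature.….norm_apply_effAction_sub_le_of_linePath`) against ONE FIXED `ℂ`-linear functional of the effective action and bounds the loop and tree terms
of its derivative SEPARATELY (loop: position moments; tree: the sup route).  The functional is «the `j`-th momentum derivative at `q` in directions `v`
of the interpolated two-leg reading», complexified so that it is `ℂ`-linear.  For complex data `G : (ℤ/L)² → ℂ`, an order `j`, a point `q : Momentum` and
directions `v : Fin j → Momentum`:

* the complex cosine coefficient `G_c^ℂ(x) := (Re G)_c(x) + i·(Im G)_c(x)` equals `L⁻² Σ_k G(k)·cos(p_k·x̃)` (`cosCoeffC_eq_sum`) — manifestly `ℂ`-linear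
  (`cosCoeffC_add`, `cosCoeffC_smul`) — with `‖G_c^ℂ(x)‖ ≤ |(Re G)_c(x)| + |(Im G)_c(x)|` and, for an even weight `w ≥ 0`,
  `Σ_x w(x)‖G_c^ℂ(x)‖ ≤ 2·Σ_x w(x)‖𝔉⁻¹[G](x)‖` (`sum_mul_norm_cosCoeffC_le`);
* the reading-jet functional `Λ_{j,q,v}(G) := Σ_x G_c^ℂ(x)·(Dʲ h_{|x̃₀|,|x̃₁|}(q) v)` (`h` the symmetrised harmonics): `ℂ`-linear (`readingJet_add`, `readingJet_smul`),
  **`re_readingJet` / `im_readingJet`**: `Re Λ(G) = Dʲ[evalM (symInterp L (Re G))](q) v`, `Im Λ(G) = Dʲ[evalM (symInterp L (Im G))](q) v`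
  (`eval_symInterp` + termwise differentiation), and **`norm_readingJet_le`**: `‖Λ(G)‖ ≤ (Σ_x (|x̃₀|+|x̃₁|)ʲ‖G_c^ℂ(x)‖)·∏ᵢ‖vᵢ‖`
  (`norm_iteratedFDeriv_harmonicM_le`), hence `≤ 2·M_j(G)·∏ᵢ‖vᵢ‖` with the door's moment `M_j(G) = Σ_x (1+|x̃₀|+|x̃₁|)ʲ‖𝔉⁻¹[G](x)‖`
  (`norm_readingJet_le_moments`);
* the converse packaging **`norm_iteratedFDeriv_evalM_symInterp_re_le_of_readingJet`**: a bound `‖Λ_{j,q,v}(G)‖ ≤ B·∏‖vᵢ‖` for all `v` gives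
  `‖Dʲ[evalM (symInterp L (Re G))](q)‖ ≤ B` (operator norm from values).

All statements are written with the explicit expressions (no new definition).  Proofs only; nothing about the model is asserted; nothing asserts
superconductivity.  References: BGM 2006 §2.3 (2.17), §2.4 (2.36) [cite: BenfattoGiulianiMastropietro2006]; Zygmund, *Trigonometric Series* X §2.
-/

noncomputable section

namespace Summit.HubbardSuperconductivity.HubbardSuperconductivity.Theorems.EngineV8

set_option linter.dupNamespace false -- summit = problem name (single-conjunct summit), D-0017

open Finset Literature.MathematicalPhysics.QuantumLattice Literature.Probability.LatticeModels
open Summit.HubbardSuperconductivity.HubbardSuperconductivity.Theorems.KLRegimeSplit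

variable {L : ℕ} [NeZero L]

/-! ## §1 The complex cosine coefficient -/

/-- **The complex cosine coefficient is the cosine transform of the complex data**:
`((Re G)_c(x) : ℂ) + ((Im G)_c(x) : ℂ)·i = L⁻² Σ_k G(k)·cos(p_k·x̃)`. -/
theorem cosCoeffC_eq_sum (G : TorusSite 2 L → ℂ) (x : TorusSite 2 L) :
    ((torusCosCoeff L (fun k => (G k).re) x : ℂ) + (torusCosCoeff L (fun k => (G k).im) x : ℂ) * Complex.I) =
      (((L : ℂ)) ^ 2)⁻¹ * ∑ k : TorusSite 2 L, G k * ((Real.cos (∑ i : Fin 2, latticeMomentum L k i * ((x i).valMinAbs : ℝ)) : ℝ) : ℂ) := by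
  simp only [torusCosCoeff]
  push_cast
  rw [Finset.mul_sum, Finset.mul_sum, Finset.mul_sum, Finset.sum_mul, ← Finset.sum_add_distrib]
  refine Finset.sum_congr rfl fun k _ => ?_
  have hG : G k = ((G k).re : ℂ) + ((G k).im : ℂ) * Complex.I := (Complex.re_add_im (G k)).symm
  rw [hG]
  simp only [Complex.add_re, Complex.ofReal_re, Complex.mul_re, Complex.I_re, Complex.ofReal_im, Complex.I_im, mul_zero, mul_one,
    sub_zero, Complex.add_im, Complex.mul_im, zero_add, add_zero]
  ring

/-- Real part of the complex cosine coefficient. -/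
theorem cosCoeffC_re (G : TorusSite 2 L → ℂ) (x : TorusSite 2 L) :
    (((torusCosCoeff L (fun k => (G k).re) x : ℂ) + (torusCosCoeff L (fun k => (G k).im) x : ℂ) * Complex.I)).re =
      torusCosCoeff L (fun k => (G k).re) x := by
  simp

/-- Imaginary part of the complex cosine coefficient. -/
theorem cosCoeffC_im (G : TorusSite 2 L → ℂ) (x : TorusSite 2 L) :
    (((torusCosCoeff L (fun k => (G k).re) x : ℂ) + (torusCosCoeff L (fun k => (G k).im) x : ℂ) * Complex.I)).im =
      torusCosCoeff L (fun k => (G k).im) x := by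
  simp

/-- Additivity of the complex cosine coefficient in the data. -/
theorem cosCoeffC_add (G H : TorusSite 2 L → ℂ) (x : TorusSite 2 L) :
    ((torusCosCoeff L (fun k => ((G k + H k)).re) x : ℂ) + (torusCosCoeff L (fun k => ((G k + H k)).im) x : ℂ) * Complex.I) =
      ((torusCosCoeff L (fun k => (G k).re) x : ℂ) + (torusCosCoeff L (fun k => (G k).im) x : ℂ) * Complex.I) +
        ((torusCosCoeff L (fun k => (H k).re) x : ℂ) + (torusCosCoeff L (fun k => (H k).im) x : ℂ) * Complex.I) := by
  rw [cosCoeffC_eq_sum, cosCoeffC_eq_sum, cosCoeffC_eq_sum, ← mul_add, ← Finset.sum_add_distrib]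
  congr 1
  exact Finset.sum_congr rfl fun k _ => by ring

/-- Homogeneity of the complex cosine coefficient in the data (complex scalars). -/
theorem cosCoeffC_smul (c : ℂ) (G : TorusSite 2 L → ℂ) (x : TorusSite 2 L) :
    ((torusCosCoeff L (fun k => ((c * G k)).re) x : ℂ) + (torusCosCoeff L (fun k => ((c * G k)).im) x : ℂ) * Complex.I) =
      c * ((torusCosCoeff L (fun k => (G k).re) x : ℂ) + (torusCosCoeff L (fun k => (G k).im) x : ℂ) * Complex.I) := by
  rw [cosCoeffC_eq_sum, cosCoeffC_eq_sum, Finset.mul_sum, Finset.mul_sum, Finset.mul_sum]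
  exact Finset.sum_congr rfl fun k _ => by ring

/-- `‖G_c^ℂ(x)‖ ≤ |(Re G)_c(x)| + |(Im G)_c(x)|`. -/
theorem norm_cosCoeffC_le (G : TorusSite 2 L → ℂ) (x : TorusSite 2 L) :
    ‖((torusCosCoeff L (fun k => (G k).re) x : ℂ) + (torusCosCoeff L (fun k => (G k).im) x : ℂ) * Complex.I)‖ ≤
      |torusCosCoeff L (fun k => (G k).re) x| + |torusCosCoeff L (fun k => (G k).im) x| := by
  refine (norm_add_le _ _).trans (add_le_add (le_of_eq ?_) (le_of_eq ?_))
  · rw [Complex.norm_real, Real.norm_eq_abs]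
  · rw [norm_mul, Complex.norm_I, mul_one, Complex.norm_real, Real.norm_eq_abs]

/-- The imaginary part is the real part of `−i·G`: `(Im G)_c = (Re(−i·G))_c`. -/
theorem torusCosCoeff_im_eq_re_negI_mul (G : TorusSite 2 L → ℂ) (x : TorusSite 2 L) :
    torusCosCoeff L (fun k => (G k).im) x = torusCosCoeff L (fun k => ((-Complex.I * G k)).re) x := by
  congr 1
  funext k
  simp

/-- Moments of `−i·G` are the moments of `G`. -/
theorem norm_torusFourierInv_negI_mul (G : TorusSite 2 L → ℂ) (x : TorusSite 2 L) :
    ‖torusFourierInv (fun k => -Complex.I * G k) x‖ = ‖torusFourierInv G x‖ := by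
  rw [torusFourierInv_const_mul, norm_mul, norm_neg, Complex.norm_I, one_mul]

/-- **Even-weighted moments of the complex cosine coefficient**: for `w ≥ 0` with `w(−x) = w(x)`,
`Σ_x w(x)‖G_c^ℂ(x)‖ ≤ 2·Σ_x w(x)‖𝔉⁻¹[G](x)‖`. -/
theorem sum_mul_norm_cosCoeffC_le (G : TorusSite 2 L → ℂ) {w : TorusSite 2 L → ℝ} (hw0 : ∀ x, 0 ≤ w x) (hwe : ∀ x, w (-x) = w x) :
    ∑ x, w x * ‖((torusCosCoeff L (fun k => (G k).re) x : ℂ) + (torusCosCoeff L (fun k => (G k).im) x : ℂ) * Complex.I)‖ ≤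
      2 * ∑ x, w x * ‖torusFourierInv G x‖ := by
  have hre := sum_mul_abs_torusCosCoeff_re_le G hw0 hwe
  have him : ∑ x, w x * |torusCosCoeff L (fun k => (G k).im) x| ≤ ∑ x, w x * ‖torusFourierInv G x‖ := by
    have h := sum_mul_abs_torusCosCoeff_re_le (fun k => -Complex.I * G k) hw0 hwe
    simp_rw [norm_torusFourierInv_negI_mul] at h
    refine le_of_eq_of_le (Finset.sum_congr rfl fun x _ => ?_) h
    rw [torusCosCoeff_im_eq_re_negI_mul]
  calc ∑ x, w x * ‖((torusCosCoeff L (fun k => (G k).re) x : ℂ) + (torusCosCoeff L (fun k => (G k).im) x : ℂ) * Complex.I)‖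
      ≤ ∑ x, w x * (|torusCosCoeff L (fun k => (G k).re) x| + |torusCosCoeff L (fun k => (G k).im) x|) :=
        Finset.sum_le_sum fun x _ => mul_le_mul_of_nonneg_left (norm_cosCoeffC_le G x) (hw0 x)
    _ = ∑ x, w x * |torusCosCoeff L (fun k => (G k).re) x| + ∑ x, w x * |torusCosCoeff L (fun k => (G k).im) x| := by
        rw [← Finset.sum_add_distrib]; exact Finset.sum_congr rfl fun x _ => by ring
    _ ≤ ∑ x, w x * ‖torusFourierInv G x‖ + ∑ x, w x * ‖torusFourierInv G x‖ := add_le_add hre him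
    _ = 2 * ∑ x, w x * ‖torusFourierInv G x‖ := by ring

/-! ## §2 The reading-jet functional -/

/-- **Termwise differentiation of the interpolant**: `Dʲ[evalM (symInterp L f)](q) v = Σ_x f_c(x)·(Dʲ h_{|x̃₀|,|x̃₁|}(q) v)`. -/
theorem iteratedFDeriv_evalM_symInterp_apply (f : TorusSite 2 L → ℝ) (j : ℕ) (q : Momentum) (v : Fin j → Momentum) :
    iteratedFDeriv ℝ j (evalM (symInterp L f)) q v =
      ∑ x : TorusSite 2 L, torusCosCoeff L f x *
        iteratedFDeriv ℝ j (fun q : Momentum => TrigPolyC4v.harmonic (x 0).valMinAbs.natAbs (x 1).valMinAbs.natAbs (WithLp.ofLp q)) q v := by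
  have hfun : evalM (symInterp L f) = fun q : Momentum => ∑ x : TorusSite 2 L,
      (fun q : Momentum => torusCosCoeff L f x * TrigPolyC4v.harmonic (x 0).valMinAbs.natAbs (x 1).valMinAbs.natAbs (WithLp.ofLp q)) q := by
    funext q
    simp only [evalM_apply, eval_symInterp]
  have hterm : ∀ x : TorusSite 2 L, ContDiff ℝ ((j : ℕ∞) : WithTop ℕ∞)
      (fun q : Momentum => torusCosCoeff L f x * TrigPolyC4v.harmonic (x 0).valMinAbs.natAbs (x 1).valMinAbs.natAbs (WithLp.ofLp q)) :=
    fun x => contDiff_const.mul (contDiff_harmonicM _ _)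
  rw [hfun, iteratedFDeriv_fun_sum_apply fun x _ => (hterm x).contDiffAt, _root_.sum_apply]
  refine Finset.sum_congr rfl fun x _ => ?_
  have hsm : (fun q : Momentum => torusCosCoeff L f x *
      TrigPolyC4v.harmonic (x 0).valMinAbs.natAbs (x 1).valMinAbs.natAbs (WithLp.ofLp q)) =
      torusCosCoeff L f x • fun q : Momentum => TrigPolyC4v.harmonic (x 0).valMinAbs.natAbs (x 1).valMinAbs.natAbs (WithLp.ofLp q) := by
    funext q; simp [smul_eq_mul]
  rw [hsm, iteratedFDeriv_const_smul_apply ((contDiff_harmonicM _ _ (k := ((j : ℕ∞) : WithTop ℕ∞))).contDiffAt),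
    _root_.smul_apply, smul_eq_mul]

/-- **Real part of the reading-jet functional** = the momentum jet of the interpolated REAL part:
`Re Σ_x G_c^ℂ(x)·(Dʲh_x(q) v) = Dʲ[evalM (symInterp L (Re G))](q) v`. -/
theorem re_readingJet (G : TorusSite 2 L → ℂ) (j : ℕ) (q : Momentum) (v : Fin j → Momentum) :
    (∑ x : TorusSite 2 L, ((torusCosCoeff L (fun k => (G k).re) x : ℂ) + (torusCosCoeff L (fun k => (G k).im) x : ℂ) * Complex.I) *
        ((iteratedFDeriv ℝ j (fun q : Momentum => TrigPolyC4v.harmonic (x 0).valMinAbs.natAbs (x 1).valMinAbs.natAbs (WithLp.ofLp q)) q v : ℝ) :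
          ℂ)).re =
      iteratedFDeriv ℝ j (evalM (symInterp L (fun k => (G k).re))) q v := by
  rw [iteratedFDeriv_evalM_symInterp_apply, Complex.re_sum]
  refine Finset.sum_congr rfl fun x _ => ?_
  simp

/-- **Imaginary part of the reading-jet functional** = the momentum jet of the interpolated IMAGINARY part. -/
theorem im_readingJet (G : TorusSite 2 L → ℂ) (j : ℕ) (q : Momentum) (v : Fin j → Momentum) :
    (∑ x : TorusSite 2 L, ((torusCosCoeff L (fun k => (G k).re) x : ℂ) + (torusCosCoeff L (fun k => (G k).im) x : ℂ) * Complex.I) *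
        ((iteratedFDeriv ℝ j (fun q : Momentum => TrigPolyC4v.harmonic (x 0).valMinAbs.natAbs (x 1).valMinAbs.natAbs (WithLp.ofLp q)) q v : ℝ) :
          ℂ)).im =
      iteratedFDeriv ℝ j (evalM (symInterp L (fun k => (G k).im))) q v := by
  rw [iteratedFDeriv_evalM_symInterp_apply, Complex.im_sum]
  refine Finset.sum_congr rfl fun x _ => ?_
  simp

/-- Additivity of the reading-jet functional in the data. -/
theorem readingJet_add (G H : TorusSite 2 L → ℂ) (j : ℕ) (q : Momentum) (v : Fin j → Momentum) :
    ∑ x : TorusSite 2 L, ((torusCosCoeff L (fun k => ((G k + H k)).re) x : ℂ) + (torusCosCoeff L (fun k => ((G k + H k)).im) x : ℂ) * Complex.I) *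
        ((iteratedFDeriv ℝ j (fun q : Momentum => TrigPolyC4v.harmonic (x 0).valMinAbs.natAbs (x 1).valMinAbs.natAbs (WithLp.ofLp q)) q v : ℝ) :
          ℂ) =
      ∑ x : TorusSite 2 L, ((torusCosCoeff L (fun k => (G k).re) x : ℂ) + (torusCosCoeff L (fun k => (G k).im) x : ℂ) * Complex.I) *
          ((iteratedFDeriv ℝ j (fun q : Momentum => TrigPolyC4v.harmonic (x 0).valMinAbs.natAbs (x 1).valMinAbs.natAbs (WithLp.ofLp q)) q v : ℝ) :
            ℂ) +
        ∑ x : TorusSite 2 L, ((torusCosCoeff L (fun k => (H k).re) x : ℂ) + (torusCosCoeff L (fun k => (H k).im) x : ℂ) * Complex.I) *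
          ((iteratedFDeriv ℝ j (fun q : Momentum => TrigPolyC4v.harmonic (x 0).valMinAbs.natAbs (x 1).valMinAbs.natAbs (WithLp.ofLp q)) q v : ℝ) :
            ℂ) := by
  rw [← Finset.sum_add_distrib]
  refine Finset.sum_congr rfl fun x _ => ?_
  rw [cosCoeffC_add, add_mul]

/-- Homogeneity of the reading-jet functional in the data (complex scalars). -/
theorem readingJet_smul (c : ℂ) (G : TorusSite 2 L → ℂ) (j : ℕ) (q : Momentum) (v : Fin j → Momentum) :
    ∑ x : TorusSite 2 L, ((torusCosCoeff L (fun k => ((c * G k)).re) x : ℂ) + (torusCosCoeff L (fun k => ((c * G k)).im) x : ℂ) * Complex.I) *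
        ((iteratedFDeriv ℝ j (fun q : Momentum => TrigPolyC4v.harmonic (x 0).valMinAbs.natAbs (x 1).valMinAbs.natAbs (WithLp.ofLp q)) q v : ℝ) :
          ℂ) =
      c * ∑ x : TorusSite 2 L, ((torusCosCoeff L (fun k => (G k).re) x : ℂ) + (torusCosCoeff L (fun k => (G k).im) x : ℂ) * Complex.I) *
          ((iteratedFDeriv ℝ j (fun q : Momentum => TrigPolyC4v.harmonic (x 0).valMinAbs.natAbs (x 1).valMinAbs.natAbs (WithLp.ofLp q)) q v : ℝ) :
            ℂ) := by
  rw [Finset.mul_sum]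
  refine Finset.sum_congr rfl fun x _ => ?_
  rw [cosCoeffC_smul, mul_assoc]

/-- **Bound of the reading-jet functional by the pure moments of the complex cosine coefficients**:
`‖Λ_{j,q,v}(G)‖ ≤ (Σ_x (|x̃₀|+|x̃₁|)ʲ‖G_c^ℂ(x)‖)·∏ᵢ‖vᵢ‖`. -/
theorem norm_readingJet_le (G : TorusSite 2 L → ℂ) (j : ℕ) (q : Momentum) (v : Fin j → Momentum) :
    ‖∑ x : TorusSite 2 L, ((torusCosCoeff L (fun k => (G k).re) x : ℂ) + (torusCosCoeff L (fun k => (G k).im) x : ℂ) * Complex.I) *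
        ((iteratedFDeriv ℝ j (fun q : Momentum => TrigPolyC4v.harmonic (x 0).valMinAbs.natAbs (x 1).valMinAbs.natAbs (WithLp.ofLp q)) q v : ℝ) :
          ℂ)‖ ≤
      (∑ x : TorusSite 2 L, (((x 0).valMinAbs.natAbs : ℝ) + ((x 1).valMinAbs.natAbs : ℝ)) ^ j *
          ‖((torusCosCoeff L (fun k => (G k).re) x : ℂ) + (torusCosCoeff L (fun k => (G k).im) x : ℂ) * Complex.I)‖) *
        ∏ i, ‖v i‖ := by
  rw [Finset.sum_mul]
  refine (norm_sum_le _ _).trans (Finset.sum_le_sum fun x _ => ?_)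
  rw [norm_mul, Complex.norm_real, Real.norm_eq_abs]
  have h1 : |iteratedFDeriv ℝ j (fun q : Momentum => TrigPolyC4v.harmonic (x 0).valMinAbs.natAbs (x 1).valMinAbs.natAbs (WithLp.ofLp q)) q v| ≤
      (((x 0).valMinAbs.natAbs : ℝ) + ((x 1).valMinAbs.natAbs : ℝ)) ^ j * ∏ i, ‖v i‖ := by
    rw [← Real.norm_eq_abs]
    refine (ContinuousMultilinearMap.le_opNorm _ _).trans ?_
    exact mul_le_mul_of_nonneg_right (norm_iteratedFDeriv_harmonicM_le _ _ j q) (Finset.prod_nonneg fun i _ => norm_nonneg _)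
  calc ‖((torusCosCoeff L (fun k => (G k).re) x : ℂ) + (torusCosCoeff L (fun k => (G k).im) x : ℂ) * Complex.I)‖ *
        |iteratedFDeriv ℝ j (fun q : Momentum => TrigPolyC4v.harmonic (x 0).valMinAbs.natAbs (x 1).valMinAbs.natAbs (WithLp.ofLp q)) q v|
      ≤ ‖((torusCosCoeff L (fun k => (G k).re) x : ℂ) + (torusCosCoeff L (fun k => (G k).im) x : ℂ) * Complex.I)‖ *
          ((((x 0).valMinAbs.natAbs : ℝ) + ((x 1).valMinAbs.natAbs : ℝ)) ^ j * ∏ i, ‖v i‖) := mul_le_mul_of_nonneg_left h1 (norm_nonneg _)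
    _ = (((x 0).valMinAbs.natAbs : ℝ) + ((x 1).valMinAbs.natAbs : ℝ)) ^ j *
          ‖((torusCosCoeff L (fun k => (G k).re) x : ℂ) + (torusCosCoeff L (fun k => (G k).im) x : ℂ) * Complex.I)‖ * ∏ i, ‖v i‖ := by ring

/-- **… hence by the door's moments**: `‖Λ_{j,q,v}(G)‖ ≤ 2·(Σ_x (1+|x̃₀|+|x̃₁|)ʲ‖𝔉⁻¹[G](x)‖)·∏ᵢ‖vᵢ‖`. -/
theorem norm_readingJet_le_moments (G : TorusSite 2 L → ℂ) (j : ℕ) (q : Momentum) (v : Fin j → Momentum) :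
    ‖∑ x : TorusSite 2 L, ((torusCosCoeff L (fun k => (G k).re) x : ℂ) + (torusCosCoeff L (fun k => (G k).im) x : ℂ) * Complex.I) *
        ((iteratedFDeriv ℝ j (fun q : Momentum => TrigPolyC4v.harmonic (x 0).valMinAbs.natAbs (x 1).valMinAbs.natAbs (WithLp.ofLp q)) q v : ℝ) :
          ℂ)‖ ≤
      2 * (∑ x : TorusSite 2 L, (1 + ((x 0).valMinAbs.natAbs : ℝ) + ((x 1).valMinAbs.natAbs : ℝ)) ^ j * ‖torusFourierInv G x‖) * ∏ i, ‖v i‖ := by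
  refine (norm_readingJet_le G j q v).trans (mul_le_mul_of_nonneg_right ?_ (Finset.prod_nonneg fun i _ => norm_nonneg _))
  set w : TorusSite 2 L → ℝ := fun x => (1 + ((x 0).valMinAbs.natAbs : ℝ) + ((x 1).valMinAbs.natAbs : ℝ)) ^ j with hw
  have hw0 : ∀ x, 0 ≤ w x := fun x => by rw [hw]; positivity
  have hwe : ∀ x, w (-x) = w x := fun x => by simp only [hw]; exact momentWeight₂_pow_neg j x
  have h := sum_mul_norm_cosCoeffC_le G hw0 hwe
  refine le_trans (Finset.sum_le_sum fun x _ => ?_) h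
  refine mul_le_mul_of_nonneg_right ?_ (norm_nonneg _)
  exact pow_le_pow_left₀ (by positivity) (by linarith) j

/-! ## §3 Operator norm of the jet from the functional's values -/

/-- **From functional bounds to the jet norm**: if `‖Λ_{j,q,v}(G)‖ ≤ B·∏ᵢ‖vᵢ‖` for every `v`, then `‖Dʲ[evalM (symInterp L (Re G))](q)‖ ≤ B`. -/
theorem norm_iteratedFDeriv_evalM_symInterp_re_le_of_readingJet (G : TorusSite 2 L → ℂ) (j : ℕ) (q : Momentum) {B : ℝ} (hB : 0 ≤ B)
    (h : ∀ v : Fin j → Momentum,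
      ‖∑ x : TorusSite 2 L, ((torusCosCoeff L (fun k => (G k).re) x : ℂ) + (torusCosCoeff L (fun k => (G k).im) x : ℂ) * Complex.I) *
          ((iteratedFDeriv ℝ j (fun q : Momentum => TrigPolyC4v.harmonic (x 0).valMinAbs.natAbs (x 1).valMinAbs.natAbs (WithLp.ofLp q)) q v : ℝ) :
            ℂ)‖ ≤ B * ∏ i, ‖v i‖) :
    ‖iteratedFDeriv ℝ j (evalM (symInterp L (fun k => (G k).re))) q‖ ≤ B := by
  refine ContinuousMultilinearMap.opNorm_le_bound hB fun v => ?_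
  rw [← re_readingJet G j q v, Real.norm_eq_abs]
  exact (Complex.abs_re_le_norm _).trans (h v)

/-- The same for the imaginary part: `‖Dʲ[evalM (symInterp L (Im G))](q)‖ ≤ B`. -/
theorem norm_iteratedFDeriv_evalM_symInterp_im_le_of_readingJet (G : TorusSite 2 L → ℂ) (j : ℕ) (q : Momentum) {B : ℝ} (hB : 0 ≤ B)
    (h : ∀ v : Fin j → Momentum,
      ‖∑ x : TorusSite 2 L, ((torusCosCoeff L (fun k => (G k).re) x : ℂ) + (torusCosCoeff L (fun k => (G k).im) x : ℂ) * Complex.I) *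
          ((iteratedFDeriv ℝ j (fun q : Momentum => TrigPolyC4v.harmonic (x 0).valMinAbs.natAbs (x 1).valMinAbs.natAbs (WithLp.ofLp q)) q v : ℝ) :
            ℂ)‖ ≤ B * ∏ i, ‖v i‖) :
    ‖iteratedFDeriv ℝ j (evalM (symInterp L (fun k => (G k).im))) q‖ ≤ B := by
  refine ContinuousMultilinearMap.opNorm_le_bound hB fun v => ?_
  rw [← im_readingJet G j q v, Real.norm_eq_abs]
  exact (Complex.abs_im_le_norm _).trans (h v)

/-- **Conversely, jet bounds of the real and imaginary parts bound the functional**: `‖Λ_{j,q,v}(G)‖ ≤ (A + A′)·∏ᵢ‖vᵢ‖` whenever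
`‖Dʲ[evalM (symInterp L (Re G))](q)‖ ≤ A` and `‖Dʲ[evalM (symInterp L (Im G))](q)‖ ≤ A′` — the form in which the SUP route feeds the tree term. -/
theorem norm_readingJet_le_of_jets (G : TorusSite 2 L → ℂ) (j : ℕ) (q : Momentum) (v : Fin j → Momentum) {A A' : ℝ}
    (hA : ‖iteratedFDeriv ℝ j (evalM (symInterp L (fun k => (G k).re))) q‖ ≤ A)
    (hA' : ‖iteratedFDeriv ℝ j (evalM (symInterp L (fun k => (G k).im))) q‖ ≤ A') :
    ‖∑ x : TorusSite 2 L, ((torusCosCoeff L (fun k => (G k).re) x : ℂ) + (torusCosCoeff L (fun k => (G k).im) x : ℂ) * Complex.I) *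
        ((iteratedFDeriv ℝ j (fun q : Momentum => TrigPolyC4v.harmonic (x 0).valMinAbs.natAbs (x 1).valMinAbs.natAbs (WithLp.ofLp q)) q v : ℝ) :
          ℂ)‖ ≤ (A + A') * ∏ i, ‖v i‖ := by
  set z := ∑ x : TorusSite 2 L, ((torusCosCoeff L (fun k => (G k).re) x : ℂ) + (torusCosCoeff L (fun k => (G k).im) x : ℂ) * Complex.I) *
        ((iteratedFDeriv ℝ j (fun q : Momentum => TrigPolyC4v.harmonic (x 0).valMinAbs.natAbs (x 1).valMinAbs.natAbs (WithLp.ofLp q)) q v : ℝ) :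
          ℂ) with hz
  have hre : |z.re| ≤ A * ∏ i, ‖v i‖ := by
    rw [hz, re_readingJet, ← Real.norm_eq_abs]
    exact (ContinuousMultilinearMap.le_opNorm _ _).trans (mul_le_mul_of_nonneg_right hA (Finset.prod_nonneg fun i _ => norm_nonneg _))
  have him : |z.im| ≤ A' * ∏ i, ‖v i‖ := by
    rw [hz, im_readingJet, ← Real.norm_eq_abs]
    exact (ContinuousMultilinearMap.le_opNorm _ _).trans (mul_le_mul_of_nonneg_right hA' (Finset.prod_nonneg fun i _ => norm_nonneg _))
  calc ‖z‖ ≤ |z.re| + |z.im| := Complex.norm_le_abs_re_add_abs_im z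
    _ ≤ A * ∏ i, ‖v i‖ + A' * ∏ i, ‖v i‖ := add_le_add hre him
    _ = (A + A') * ∏ i, ‖v i‖ := by ring

end Summit.HubbardSuperconductivity.HubbardSuperconductivity.Theorems.EngineV8

end
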